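import Mathlib.Analysis.SpecialFunctions.ImproperIntegrals
import Mathlib.MeasureTheory.Integral.IntegralEqImproper
import HarnessLib

/-!
# Finite reach of fixed-point Laguerre certificates — part 1: the forward Laplace average (abstract)

Cell rh-split (D-0116 arm), ENGINE 5 (rh-splitx-eng-5 g4), object (ii) of lead RULING #212 (candidate barrier
sentence for the pointwise-certificate method of class (xviii), dbn linear ray).  The kernel refutations of the
linear-factor ray `HasOnlyRealZeros (linearFactorH a)` (`Literature/Barriers/RiemannHypothesis/NewmanConjecture.lean`)
in `Theorems/Splittings/LinearRayOnePoint*.lean` / `LinearRayTwoPoint.lean` / `LinearRayLehmerWindow*.lean` all rest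
on a Laguerre certificate at ONE or TWO fixed real points of `H_0 = deBruijnH 0`, built from the forward average
`Q_a(s) = ∫₀^∞ H_0(s+y) e^{−ay} dy`:
* one-point (`LinearRayOnePoint.not_linearRay_of_onePoint`): `H_0(s)² < Q_a(s)·(a H_0(s) − H_0′(s))`;
* two-point (`LinearRayTwoPoint.not_linearRay_of_signChange`): `Q_a > 0` on `[x, x′]` with `H_0(x) > 0 > H_0(x′)`.
This file proves, RH-free and for ARBITRARY data, that both shapes fail for all sufficiently large `a`:
`a·Q_a(s) = H_0(s) + Q_a[H_0′](s)` (integration by parts), whence `Q_a(s) = H_0(s)/a + H_0′(s)/a² + O(a⁻³)` and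
`Q_a(s)(aH_0(s) − H_0′(s)) − H_0(s)² = H_0·Q_a[H_0′] − H_0′·Q_a[H_0] = (H_0H_0″ − H_0′²)(s)/a² + O(a⁻³)`.
So (1) wherever the strict Laguerre inequality `H_0′(s)² > H_0(s)H_0″(s)` holds — in particular at every SIMPLE
real zero of `H_0` — the one-point certificate is false for `a ≥ a₀(s)` (`onePoint_certificate_finite_reach`,
`…_at_simple_zero`); (2) at every `x′` with `H_0(x′) < 0` the forward average `Q_a(x′)` is negative for
`a ≥ a₀(x′)`, so the two-point certificate's positivity hypothesis fails at its own right endpoint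
(`twoPoint_certificate_finite_reach`).  The abstract statements (`laplaceFwd_*`, any `C³` function with bounded
derivatives) come first; the constants are explicit (`a₀ = 2M²/δ`, `a₀ = M/|H_0(x′)|` with
`M = 6∫₀^∞ |Φ(u)|e^{u} du ≥ sup|H_0^{(k)}|`, `k ≤ 3`).
BARRIER SENTENCE (candidate, for the referee): «every fixed-pair / fixed-point Laguerre certificate against the
linear ray has finite reach a_max(point) — each further range of a needs new points (closer pairs of zeros higher
up); the method cannot give the a-uniform statement.»  Nothing here uses or bears on RH.
HONEST LABEL: RH-free by-product about a refutation METHOD for an RH-STRENGTHENING conjunct; not a splitting;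
nothing here bears on the truth of RH.
-/

set_option linter.dupNamespace false

noncomputable section

namespace Summit.RiemannHypothesis.RiemannHypothesis.Theorems.Splittings.LinearRayFiniteReach

open Set MeasureTheory Filter Topology

/-! ## The forward Laplace average of a bounded continuous function -/

/-- Integrability and the trivial bound: for continuous `g` with `|g| ≤ M` and `a > 0`,
`y ↦ g(s+y)e^{−ay}` is integrable on `(0, ∞)` and `|∫₀^∞ g(s+y)e^{−ay} dy| ≤ M/a`. [folklore] -/
theorem laplaceFwd_bound {g : ℝ → ℝ} (hg : Continuous g) {M : ℝ} (hM : ∀ x, |g x| ≤ M) {a : ℝ} (ha : 0 < a)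
    (s : ℝ) :
    IntegrableOn (fun y : ℝ => g (s + y) * Real.exp (-(a * y))) (Ioi 0) ∧
      |∫ y in Ioi (0:ℝ), g (s + y) * Real.exp (-(a * y))| ≤ M / a := by
  have hM0 : 0 ≤ M := (abs_nonneg _).trans (hM s)
  have hmaj : IntegrableOn (fun y : ℝ => M * Real.exp (-a * y)) (Ioi 0) :=
    (integrableOn_exp_mul_Ioi (by linarith) 0).const_mul M
  have hcont : Continuous fun y : ℝ => g (s + y) * Real.exp (-(a * y)) :=
    (hg.comp (continuous_const.add continuous_id)).mul (by fun_prop)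
  have hpt : ∀ y ∈ Ioi (0:ℝ), ‖g (s + y) * Real.exp (-(a * y))‖ ≤ M * Real.exp (-a * y) := by
    intro y _
    rw [norm_mul, Real.norm_eq_abs, Real.norm_eq_abs, abs_of_pos (Real.exp_pos _),
      show -(a * y) = -a * y by ring]
    exact mul_le_mul_of_nonneg_right (hM _) (Real.exp_pos _).le
  have hint : IntegrableOn (fun y : ℝ => g (s + y) * Real.exp (-(a * y))) (Ioi 0) :=
    Integrable.mono' hmaj hcont.aestronglyMeasurable
      ((ae_restrict_iff' measurableSet_Ioi).2 (Filter.Eventually.of_forall hpt))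
  refine ⟨hint, ?_⟩
  have h1 : ‖∫ y in Ioi (0:ℝ), g (s + y) * Real.exp (-(a * y))‖ ≤ ∫ y in Ioi (0:ℝ), M * Real.exp (-a * y) :=
    norm_integral_le_of_norm_le hmaj ((ae_restrict_iff' measurableSet_Ioi).2 (Filter.Eventually.of_forall hpt))
  rw [Real.norm_eq_abs] at h1
  refine h1.trans (le_of_eq ?_)
  rw [integral_const_mul, integral_exp_mul_Ioi (by linarith) 0]
  simp only [mul_zero, Real.exp_zero]
  field_simp

/-- **Integration by parts on `[0, ∞)`**: for `g` with derivative `g′`, both continuous and bounded by `M`,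
and `a > 0`:  `a · ∫₀^∞ g(s+y)e^{−ay} dy = g(s) + ∫₀^∞ g′(s+y)e^{−ay} dy`. [folklore] -/
theorem laplaceFwd_ibp {g g' : ℝ → ℝ} (hgd : ∀ x, HasDerivAt g (g' x) x) (hg' : Continuous g') {M : ℝ}
    (hM : ∀ x, |g x| ≤ M) (hM' : ∀ x, |g' x| ≤ M) {a : ℝ} (ha : 0 < a) (s : ℝ) :
    a * ∫ y in Ioi (0:ℝ), g (s + y) * Real.exp (-(a * y)) =
      g s + ∫ y in Ioi (0:ℝ), g' (s + y) * Real.exp (-(a * y)) := by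
  have hg : Continuous g := continuous_iff_continuousAt.2 fun x => (hgd x).continuousAt
  obtain ⟨hI, -⟩ := laplaceFwd_bound hg hM ha s
  obtain ⟨hI', -⟩ := laplaceFwd_bound hg' hM' ha s
  -- G(y) = −g(s+y)e^{−ay}, G′(y) = a g(s+y) e^{−ay} − g′(s+y) e^{−ay}
  set G : ℝ → ℝ := fun y => -(g (s + y) * Real.exp (-(a * y))) with hG
  have hGd : ∀ y, HasDerivAt G (a * (g (s + y) * Real.exp (-(a * y))) - g' (s + y) * Real.exp (-(a * y))) y := by
    intro y
    have h1 : HasDerivAt (fun y : ℝ => g (s + y)) (g' (s + y)) y := by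
      have := (hgd (s + y)).comp y ((hasDerivAt_id y).const_add s)
      simpa [Function.comp_def] using this
    have h2 : HasDerivAt (fun y : ℝ => Real.exp (-(a * y))) (Real.exp (-(a * y)) * (-a)) y := by
      have h0 : HasDerivAt (fun y : ℝ => -a * y) (-a * 1) y := (hasDerivAt_id' y).const_mul (-a)
      have : HasDerivAt (fun y : ℝ => -(a * y)) (-a) y := by
        refine (h0.congr_of_eventuallyEq ?_).congr_deriv (by ring)
        exact Filter.Eventually.of_forall fun x => by ring
      exact this.exp
    have h3 := (h1.mul h2).neg
    refine h3.congr_deriv ?_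
    ring
  have hGint : IntegrableOn (fun y => a * (g (s + y) * Real.exp (-(a * y))) - g' (s + y) * Real.exp (-(a * y))) (Ioi 0) :=
    (hI.const_mul a).sub hI'
  have hGlim : Tendsto G atTop (𝓝 0) := by
    have hM0 : 0 ≤ M := (abs_nonneg _).trans (hM s)
    have hexp : Tendsto (fun y : ℝ => M * Real.exp (-(a * y))) atTop (𝓝 0) := by
      have : Tendsto (fun y : ℝ => Real.exp (-(a * y))) atTop (𝓝 0) := by
        have h1 : Tendsto (fun y : ℝ => -a * y) atTop atBot :=
          tendsto_id.const_mul_atTop_of_neg (neg_neg_of_pos ha)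
        have h2 : Tendsto (fun y : ℝ => -(a * y)) atTop atBot :=
          h1.congr fun y => by ring
        exact Real.tendsto_exp_atBot.comp h2
      simpa using this.const_mul M
    refine squeeze_zero_norm (fun y => ?_) hexp
    rw [hG, norm_neg, norm_mul, Real.norm_eq_abs, Real.norm_eq_abs, abs_of_pos (Real.exp_pos _)]
    exact mul_le_mul_of_nonneg_right (hM _) (Real.exp_pos _).le
  have hcw : ContinuousWithinAt G (Ici 0) 0 := (hGd 0).continuousAt.continuousWithinAt
  have key := integral_Ioi_of_hasDerivAt_of_tendsto hcw (fun y _ => hGd y) hGint hGlim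
  rw [integral_sub (hI.const_mul a) hI', integral_const_mul] at key
  have hG0 : G 0 = -g s := by simp [hG]
  rw [hG0] at key
  linarith

/-- **Second-order expansion**: for `g ∈ C²` with `g, g′, g″` continuous and bounded by `M`, `a > 0`:
`|∫₀^∞ g(s+y)e^{−ay} dy − g(s)/a − g′(s)/a²| ≤ M/a³`. [folklore] -/
theorem laplaceFwd_expansion {g g' g'' : ℝ → ℝ} (hgd : ∀ x, HasDerivAt g (g' x) x)
    (hgd' : ∀ x, HasDerivAt g' (g'' x) x) (hg'' : Continuous g'') {M : ℝ}
    (hM : ∀ x, |g x| ≤ M) (hM' : ∀ x, |g' x| ≤ M) (hM'' : ∀ x, |g'' x| ≤ M) {a : ℝ} (ha : 0 < a) (s : ℝ) :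
    |(∫ y in Ioi (0:ℝ), g (s + y) * Real.exp (-(a * y))) - g s / a - g' s / a ^ 2| ≤ M / a ^ 3 := by
  have hg' : Continuous g' := continuous_iff_continuousAt.2 fun x => (hgd' x).continuousAt
  have e1 := laplaceFwd_ibp hgd hg' hM hM' ha s
  have e2 := laplaceFwd_ibp hgd' hg'' hM' hM'' ha s
  obtain ⟨-, hb⟩ := laplaceFwd_bound hg'' hM'' ha s
  set L0 := ∫ y in Ioi (0:ℝ), g (s + y) * Real.exp (-(a * y))
  set L1 := ∫ y in Ioi (0:ℝ), g' (s + y) * Real.exp (-(a * y))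
  set L2 := ∫ y in Ioi (0:ℝ), g'' (s + y) * Real.exp (-(a * y))
  -- L0 = g/a + L1/a, L1 = g'/a + L2/a
  have hL0 : L0 = g s / a + L1 / a := by field_simp; linarith
  have hL1 : L1 = g' s / a + L2 / a := by field_simp; linarith
  have hexpr : L0 - g s / a - g' s / a ^ 2 = L2 / a ^ 2 := by
    rw [hL0, hL1]; field_simp; ring
  rw [hexpr, abs_div, abs_of_pos (by positivity : (0:ℝ) < a ^ 2)]
  calc |L2| / a ^ 2 ≤ (M / a) / a ^ 2 := div_le_div_of_nonneg_right hb (by positivity)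
    _ = M / a ^ 3 := by field_simp

/-! ## Finite reach of the two certificate shapes (abstract) -/

/-- **One-point shape.** For `f ∈ C³` with `f, f′, f″, f‴` bounded by `M`, at a point `s` where the strict
Laguerre inequality `f′(s)² > f(s)f″(s)` holds, the one-point expression
`(∫₀^∞ f(s+y)e^{−ay}dy)·(a f(s) − f′(s)) − f(s)²` is NEGATIVE for every `a > 2M²/(f′(s)² − f(s)f″(s))`. [folklore] -/
theorem onePoint_expr_neg_of_large {f f' f'' f''' : ℝ → ℝ} (hd0 : ∀ x, HasDerivAt f (f' x) x)
    (hd1 : ∀ x, HasDerivAt f' (f'' x) x) (hd2 : ∀ x, HasDerivAt f'' (f''' x) x) (hc3 : Continuous f''')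
    {M : ℝ} (hM0 : ∀ x, |f x| ≤ M) (hM1 : ∀ x, |f' x| ≤ M) (hM2 : ∀ x, |f'' x| ≤ M) (hM3 : ∀ x, |f''' x| ≤ M)
    {s : ℝ} (hLag : f s * f'' s < f' s ^ 2) {a : ℝ} (ha0 : 0 < a)
    (ha : 2 * M ^ 2 / (f' s ^ 2 - f s * f'' s) < a) :
    (∫ y in Ioi (0:ℝ), f (s + y) * Real.exp (-(a * y))) * (a * f s - f' s) - f s ^ 2 < 0 := by
  have hc2 : Continuous f'' := continuous_iff_continuousAt.2 fun x => (hd2 x).continuousAt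
  have hc1 : Continuous f' := continuous_iff_continuousAt.2 fun x => (hd1 x).continuousAt
  set δ := f' s ^ 2 - f s * f'' s with hδ
  have hδ0 : 0 < δ := by rw [hδ]; linarith
  set L0 := ∫ y in Ioi (0:ℝ), f (s + y) * Real.exp (-(a * y)) with hL0def
  set L1 := ∫ y in Ioi (0:ℝ), f' (s + y) * Real.exp (-(a * y)) with hL1def
  -- the identity C = f·L1 − f′·L0
  have hibp := laplaceFwd_ibp hd0 hc1 hM0 hM1 ha0 s
  have hC : L0 * (a * f s - f' s) - f s ^ 2 = f s * L1 - f' s * L0 := by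
    linear_combination (f s) * hibp
  rw [hC]
  -- expansions of L0 and L1
  have hE0 := laplaceFwd_expansion hd0 hd1 hc2 hM0 hM1 hM2 ha0 s
  have hE1 := laplaceFwd_expansion hd1 hd2 hc3 hM1 hM2 hM3 ha0 s
  rw [← hL0def] at hE0
  rw [← hL1def] at hE1
  set ρ0 := L0 - f s / a - f' s / a ^ 2 with hρ0
  set ρ1 := L1 - f' s / a - f'' s / a ^ 2 with hρ1
  have eL0 : L0 = f s / a + f' s / a ^ 2 + ρ0 := by rw [hρ0]; ring
  have eL1 : L1 = f' s / a + f'' s / a ^ 2 + ρ1 := by rw [hρ1]; ring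
  have hmain : f s * L1 - f' s * L0 = -δ / a ^ 2 + (f s * ρ1 - f' s * ρ0) := by
    rw [eL0, eL1, hδ]; field_simp; ring
  rw [hmain]
  -- |f ρ1 − f′ ρ0| ≤ 2M²/a³
  have hfs : |f s| ≤ M := hM0 s
  have hf's : |f' s| ≤ M := hM1 s
  have hMnn : 0 ≤ M := (abs_nonneg _).trans hfs
  have hrem : f s * ρ1 - f' s * ρ0 ≤ 2 * M ^ 2 / a ^ 3 := by
    have h1 : f s * ρ1 ≤ M * (M / a ^ 3) := by
      have := abs_mul (f s) ρ1
      have hle : |f s * ρ1| ≤ M * (M / a ^ 3) := by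
        rw [this]; exact mul_le_mul hfs hE1 (abs_nonneg _) hMnn
      exact (le_abs_self _).trans hle
    have h2 : -(f' s * ρ0) ≤ M * (M / a ^ 3) := by
      have hle : |f' s * ρ0| ≤ M * (M / a ^ 3) := by
        rw [abs_mul]; exact mul_le_mul hf's hE0 (abs_nonneg _) hMnn
      exact (neg_le_abs _).trans hle
    have e : M * (M / a ^ 3) + M * (M / a ^ 3) = 2 * M ^ 2 / a ^ 3 := by ring
    linarith
  -- −δ/a² + 2M²/a³ < 0  ⟸  2M²/δ < a
  have ha3 : 0 < a ^ 3 := by positivity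
  have hkey : 2 * M ^ 2 / a ^ 3 < δ / a ^ 2 := by
    have h1 : 2 * M ^ 2 < a * δ := by
      have := (div_lt_iff₀ hδ0).1 ha
      linarith
    rw [lt_div_iff₀ (by positivity : (0:ℝ) < a ^ 2)]
    have e : 2 * M ^ 2 / a ^ 3 * a ^ 2 = 2 * M ^ 2 / a := by field_simp
    rw [e, div_lt_iff₀ ha0]
    linarith
  have : -δ / a ^ 2 = -(δ / a ^ 2) := by ring
  rw [this]
  linarith

/-- **Two-point shape (endpoint).** For `f ∈ C¹` with `f, f′` bounded by `M`: if `f(s) < 0`, then the forward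
average `∫₀^∞ f(s+y)e^{−ay}dy` is NEGATIVE for every `a > M/|f(s)|`; symmetrically for `f(s) > 0`. [folklore] -/
theorem laplaceFwd_neg_of_large {f f' : ℝ → ℝ} (hd0 : ∀ x, HasDerivAt f (f' x) x) (hc1 : Continuous f')
    {M : ℝ} (hM0 : ∀ x, |f x| ≤ M) (hM1 : ∀ x, |f' x| ≤ M) {s : ℝ} (hs : f s < 0) {a : ℝ} (ha0 : 0 < a)
    (ha : M / |f s| < a) :
    (∫ y in Ioi (0:ℝ), f (s + y) * Real.exp (-(a * y))) < 0 := by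
  have hibp := laplaceFwd_ibp hd0 hc1 hM0 hM1 ha0 s
  obtain ⟨-, hb⟩ := laplaceFwd_bound hc1 hM1 ha0 s
  set L0 := ∫ y in Ioi (0:ℝ), f (s + y) * Real.exp (-(a * y))
  set L1 := ∫ y in Ioi (0:ℝ), f' (s + y) * Real.exp (-(a * y))
  have hfs : |f s| = -f s := abs_of_neg hs
  have hpos : 0 < |f s| := abs_pos.2 hs.ne
  have h1 : M < a * |f s| := by rwa [div_lt_iff₀ hpos] at ha
  have hL1 : L1 ≤ M / a := (le_abs_self _).trans hb
  have : a * L0 = f s + L1 := hibp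
  have hlt : a * L0 < 0 := by
    rw [this, hfs] at *
    have : M / a < -f s := by
      rw [div_lt_iff₀ ha0]; linarith
    linarith
  by_contra hge
  push Not at hge
  have := mul_nonneg ha0.le hge
  linarith

/-- The mirror form: `f(s) > 0` gives a POSITIVE forward average for `a > M/|f(s)|`. [folklore] -/
theorem laplaceFwd_pos_of_large {f f' : ℝ → ℝ} (hd0 : ∀ x, HasDerivAt f (f' x) x) (hc1 : Continuous f')
    {M : ℝ} (hM0 : ∀ x, |f x| ≤ M) (hM1 : ∀ x, |f' x| ≤ M) {s : ℝ} (hs : 0 < f s) {a : ℝ} (ha0 : 0 < a)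
    (ha : M / |f s| < a) :
    0 < ∫ y in Ioi (0:ℝ), f (s + y) * Real.exp (-(a * y)) := by
  have hd0' : ∀ x, HasDerivAt (fun x => -f x) (-f' x) x := fun x => (hd0 x).neg
  have h := laplaceFwd_neg_of_large hd0' hc1.neg (M := M) (fun x => by simpa using hM0 x)
    (fun x => by simpa using hM1 x) (s := s) (by linarith) ha0 (by simpa using ha)
  have e : (∫ y in Ioi (0:ℝ), -f (s + y) * Real.exp (-(a * y))) = -∫ y in Ioi (0:ℝ), f (s + y) * Real.exp (-(a * y)) := by
    rw [← integral_neg]; congr 1; funext y; ring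
  rw [e] at h
  linarith

end Summit.RiemannHypothesis.RiemannHypothesis.Theorems.Splittings.LinearRayFiniteReach

end
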